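import Literature.NumberTheory.Automorphic.AshSmithTheoryHeckeProofs
import Literature.NumberTheory.Automorphic.AshSmithTheoryHeckeFrobeniusProofs
import HarnessLib

/-!
# Ash (2003), *Smith theory and Hecke operators* — proofs towards the named fact
# `Ash2003_inducedRayClassCharacter_attached`: the Galois side for `L = ℚ(ζ_p)`

Topic `NumberTheory/Automorphic`; fourth companion of
`Literature.NumberTheory.Automorphic.AshSmithTheoryHecke` (the named fact
`Ash2003_inducedRayClassCharacter_attached` = A. Ash, *Smith theory and Hecke operators*, J. Algebra
**259** (2003) 43–58 [Ash2003], Thm. 1.1 / Cor. 4.4).  With `AshSmithTheoryHeckeProofs`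
(unramifiedness) and `AshSmithTheoryHeckeFrobeniusProofs` (Frobenius of an induced character) this
file completes the **Galois half** of the printed proof — [Ash2003, Lemma 4.2], from Ash, Duke
Math. J. 65 (1992), Thm. 6.1.2: "`ρ_θ = Ind(G_L, G_ℚ, θ)` is attached to `χ_θ`", i.e. `ρ_θ` is
unramified at `l ∤ pM` with `det(1 - ρ_θ(Frob_l) X) = ∏_{λ ∣ l} (1 - θ([λ]) X^{f})`:

* `Ash2003.hasFrobCharpolyAt_induce_of_isGaloisAvatar`: for an odd prime `p`, `N ≥ 1`, a ray class
  character `θ` of `L = ℚ(ζ_p)` modulo `(pN)` with Galois avatar `ϑ` (`Ash2003.IsGaloisAvatar`) and a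
  finite place `v` of `ℚ` with `q_v = l ∤ p · (pN)`:
  `det(X - Ind(ϑ)(Frob_v)) = ∏_{w ∣ l} (X^{f(w|l)} - θ([w]))` (`FramedGaloisRep.HasFrobCharpolyAt`,
  product over the places `w` of `L` above `l`, `[w]` the ray class of the prime `w`, coprime to
  `(pN)` by `Ash2003.isCoprime_modulus_of_under_eq`);
* `Ash2003.exists_isAttached_induce_of_isGaloisAvatar`: consequently `Ind ϑ` IS attached, in the
  sense of [Ash2003, Def. 0.1] as typed by `Ash2003.IsAttached`, to a system of Hecke eigenvalues
  `a(l, k)` — the one read off from the coefficients of `∏_{w ∣ l} (X^{f(w|l)} - θ([w]))` (cf. Ash's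
  explicit eigencharacter `χ_θ(T_{l,k})`, [Ash2003, Thm. 4.3]).  What [Ash2003] proves beyond this —
  the automorphic half, NOT here — is that this `a` is the eigenvalue system of a Hecke eigenclass in
  `H^*(X(pN), F)` (Smith theory on `X(M)`, §§2–6).

## References

* A. Ash, *Smith theory and Hecke operators*, J. Algebra 259 (2003) 43–58, Def. 0.1, Lemma 4.2,
  Thm. 4.3 [Ash2003].
* J. Neukirch, *Algebraic Number Theory* (1999), I §9; VII §10 [NeukirchANT1999].
-/

noncomputable section

open scoped NumberField Pointwise
open IsDedekindDomain Polynomial Field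

/-! ### `L = ℚ(ζ_p)`: the Frobenius characteristic polynomial of `Ind ϑ` ([Ash2003, Lemma 4.2]) -/

namespace Literature.NumberTheory.Automorphic

namespace Ash2003

open GaloisRepresentations

/-- A place `w` of `L = ℚ(ζ_p)` above a place `v` of `ℚ` with `q_v ∤ p · (pN)` is coprime to the
modulus `(pN)` (otherwise `pN ∈ w ∩ ℤ = v`, so `q_v ∣ pN`). [folklore] -/
theorem isCoprime_modulus_of_under_eq (p : ℕ) [Fact p.Prime] {N : ℕ}
    {v : HeightOneSpectrum (𝓞 ℚ)} (hv : ¬ v.residueCard ∣ p * (p * N))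
    {w : HeightOneSpectrum (𝓞 (CyclotomicField p ℚ))} (hw : w.under (𝓞 ℚ) = v) :
    IsCoprime w.asIdeal (modulus (CyclotomicField p ℚ) (p * N)) := by
  rw [Ideal.isCoprime_iff_sup_eq]
  by_contra hne
  have hle : modulus (CyclotomicField p ℚ) (p * N) ≤ w.asIdeal := by
    have h1 := w.isMaximal.eq_of_le hne le_sup_left
    exact le_sup_right.trans h1.symm.le
  have hmem : ((p * N : ℕ) : 𝓞 (CyclotomicField p ℚ)) ∈ w.asIdeal :=
    hle (Ideal.mem_span_singleton_self _)
  have hmem' : ((p * N : ℕ) : 𝓞 ℚ) ∈ v.asIdeal := by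
    rw [← hw, HeightOneSpectrum.under_asIdeal, Ideal.under, Ideal.mem_comap, map_natCast]
    exact hmem
  exact hv ((residueCard_dvd_of_natCast_mem hmem').trans (Dvd.intro p (by ring)))

/-- **`det(X - Ind(ϑ)(Frob_l)) = ∏_{w ∣ l} (X^{f(w|l)} - θ([w]))`** — the second clause of "`ρ_θ` is
attached" ([Ash2003, Def. 0.1 and Lemma 4.2], from Ash 1992 Thm. 6.1.2) for the Galois avatar
`ϑ` of a ray class character `θ` of `L = ℚ(ζ_p)` modulo `(pN)`, in the tree's typing: for every
finite place `v` of `ℚ` with `q_v ∤ p · (pN)`, `Ind_{Γ_L}^{Γ_ℚ} ϑ` (`FramedGaloisRep.induce`) has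
arithmetic-Frobenius characteristic polynomial at `v` (`FramedGaloisRep.HasFrobCharpolyAt`) equal
to the product over the places `w ∣ v` of `L` of `X^{f(w|v)} - θ([w])`, `[w] ∈ Cl_L^{(pN)}` the ray
class of the prime `w` (`integralRayClass`; `w` is coprime to `(pN)` by
`isCoprime_modulus_of_under_eq`).  Proof: `FramedGaloisRep.exists_charpoly_induce_eq_prod` (with
`I_𝔓 ≤ Γ_L` from `inertia_le_range_absGaloisRestrict_cyclotomicField`, `q_v ≠ p`) and
`ϑ(s_w) = θ([w])` for the arithmetic Frobenii `s_w` (`IsGaloisAvatar`).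
[cite: Ash2003, Def. 0.1 and Lemma 4.2] -/
theorem hasFrobCharpolyAt_induce_of_isGaloisAvatar (p : ℕ) [hp : Fact p.Prime] {N : ℕ}
    (hN : N ≠ 0) {F : Type*} [CommRing F] [TopologicalSpace F]
    (θ : RayClassGroup (modulus (CyclotomicField p ℚ) (p * N)) →* Fˣ)
    (ϑ : FramedGaloisRep (CyclotomicField p ℚ) F 1)
    (hϑ : IsGaloisAvatar
      (modulus_ne_bot (CyclotomicField p ℚ) (mul_ne_zero (Nat.Prime.ne_zero hp.out) hN)) θ ϑ)
    {v : HeightOneSpectrum (𝓞 ℚ)} (hv : ¬ v.residueCard ∣ p * (p * N)) :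
    (FramedGaloisRep.induce ℚ (finrank_cyclotomicField p) ϑ).HasFrobCharpolyAt v
      (∏ᶠ w : {w : HeightOneSpectrum (𝓞 (CyclotomicField p ℚ)) // w.under (𝓞 ℚ) = v},
        (X ^ (w.1.asIdeal.inertiaDeg (𝓞 ℚ)) -
          C ((θ (integralRayClass (modulus (CyclotomicField p ℚ) (p * N))
            (modulus_ne_bot (CyclotomicField p ℚ) (mul_ne_zero (Nat.Prime.ne_zero hp.out) hN))
            ⟨w.1.asIdeal, w.1.ne_bot, isCoprime_modulus_of_under_eq p hv w.2⟩) : Fˣ) : F))) := by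
  classical
  intro 𝔓 h𝔓 σ hσ
  haveI : NeZero p := ⟨hp.out.ne_zero⟩
  -- Mathlib's instances are stated for `CyclotomicField.instAlgebra`; the canonical `ℚ`-algebra
  -- structure `DivisionRing.toRatAlgebra` agrees with it definitionally (not reducibly).
  haveI : IsCyclotomicExtension {p} ℚ (CyclotomicField p ℚ) :=
    CyclotomicField.isCyclotomicExtension p ℚ
  haveI : IsGalois ℚ (CyclotomicField p ℚ) := IsCyclotomicExtension.isGalois {p} ℚ _
  haveI : Fintype {w : HeightOneSpectrum (𝓞 (CyclotomicField p ℚ)) // w.under (𝓞 ℚ) = v} :=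
    @Fintype.ofFinite _ (finite_heightOneSpectrum_under_eq v)
  have hpv : (p : 𝓞 ℚ) ∉ v.asIdeal := fun h =>
    hv ((residueCard_dvd_of_natCast_mem h).trans (Dvd.intro _ rfl))
  obtain ⟨𝔔, s, h𝔔s, hprod⟩ := FramedGaloisRep.exists_charpoly_induce_eq_prod ℚ
    (finrank_cyclotomicField p) ϑ h𝔓
    (inertia_le_range_absGaloisRestrict_cyclotomicField p hpv h𝔓) hσ
  rw [hprod, finprod_eq_prod_of_fintype]
  refine Finset.prod_congr rfl fun w _ => ?_
  -- `ϑ(s_w) = θ([w])`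
  have h1 := (hϑ w.1 (isCoprime_modulus_of_under_eq p hv w.2)).2 (𝔔 w) (h𝔔s w).1 (s w)
    (h𝔔s w).2
  have h2 : FramedRep.charpoly ϑ (s w) =
      X - C (((ϑ (s w) : GL (Fin 1) F) : Matrix (Fin 1) (Fin 1) F) 0 0) := by
    unfold FramedRep.charpoly
    rw [Matrix.charpoly, Matrix.det_fin_one, Matrix.charmatrix_apply, Matrix.diagonal_apply_eq]
  rw [h2, sub_right_inj, Polynomial.C_inj] at h1
  rw [h1]

/-! ### `Ind ϑ` is attached to the eigenvalue system read off from `∏_{w ∣ l} (X^{f} - θ([w]))` -/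

/-- For a finite place `v` of `ℚ` with `q_v ∤ p · (pN)`, `p ∤ q_v` (`q_v ∈ v` is a prime multiple
of neither `p ∈ v` — else `q_v ∣ p` — nor of a proper divisor in `v`). [folklore] -/
theorem not_dvd_residueCard (p : ℕ) [hp : Fact p.Prime] {N : ℕ} {v : HeightOneSpectrum (𝓞 ℚ)}
    (hv : ¬ v.residueCard ∣ p * (p * N)) : ¬ p ∣ v.residueCard := by
  rintro ⟨m, hm⟩
  have hq : (v.residueCard : 𝓞 ℚ) ∈ v.asIdeal := Ideal.absNorm_mem v.asIdeal
  rw [hm, Nat.cast_mul] at hq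
  rcases v.isPrime.mem_or_mem hq with h | h
  · exact hv ((residueCard_dvd_of_natCast_mem h).trans (Dvd.intro _ rfl))
  · have h1 : v.residueCard ∣ m := residueCard_dvd_of_natCast_mem h
    rw [hm] at h1
    have hm0 : m ≠ 0 := by
      rintro rfl
      have := v.one_lt_residueCard
      rw [hm, mul_zero] at this
      exact absurd this (by norm_num)
    have h2 := Nat.le_of_dvd (Nat.pos_of_ne_zero hm0) h1
    have h4 : 2 * m ≤ m := (Nat.mul_le_mul_right m hp.out.two_le).trans h2
    omega

/-- **The Galois side of [Ash2003]: `ρ = Ind_{Γ_L}^{Γ_ℚ} ϑ` is attached ([Ash2003, Def. 0.1],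
`Ash2003.IsAttached`) to a system of Hecke eigenvalues.**  For an odd prime `p`, `N ≥ 1`, `F` a field
of characteristic `p`, a ray class character `θ` of `L = ℚ(ζ_p)` modulo `(pN)` and its Galois avatar
`ϑ`, there is `a : (l, k) ↦ a(l, k) ∈ F` with: for every `l ∤ p · (pN)`, `ρ` is unramified at `l`
(`isUnramifiedAt_induce_of_isGaloisAvatar`) and
`det(X - ρ(Frob_l)) = ∑_k (-1)^k l^{k(k-1)/2} a(l,k) X^{n-k}` (`heckeFrobPoly`) — namely the `a(l, ·)`
read off from the coefficients of `∏_{w ∣ l} (X^{f(w|l)} - θ([w]))`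
(`hasFrobCharpolyAt_induce_of_isGaloisAvatar`; `l` is invertible in `F`, `not_dvd_residueCard`, and
the polynomial has degree `n = p - 1` as a characteristic polynomial; cf. Ash's explicit
eigencharacter `χ_θ(T_{l,k}) = ∑_Q θ([λ_Q])`, [Ash2003, Thm. 4.3]).  The automorphic half of
[Ash2003] (that `a` is realised by a Hecke eigenclass in `H^*(X(pN), F)`) is not addressed here.
[cite: Ash2003, Def. 0.1 and Lemma 4.2] -/
theorem exists_isAttached_induce_of_isGaloisAvatar (p : ℕ) [hp : Fact p.Prime] {N : ℕ}
    (hN : N ≠ 0) {F : Type*} [Field F] [Algebra (ZMod p) F] [TopologicalSpace F]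
    (θ : RayClassGroup (modulus (CyclotomicField p ℚ) (p * N)) →* Fˣ)
    (ϑ : FramedGaloisRep (CyclotomicField p ℚ) F 1)
    (hϑ : IsGaloisAvatar
      (modulus_ne_bot (CyclotomicField p ℚ) (mul_ne_zero (Nat.Prime.ne_zero hp.out) hN)) θ ϑ) :
    ∃ a : HeightOneSpectrum (𝓞 ℚ) → ℕ → F,
      IsAttached p (p * N) (FramedGaloisRep.induce ℚ (finrank_cyclotomicField p) ϑ) a := by
  classical
  -- the Frobenius polynomial `P_v = ∏_{w ∣ v} (X^{f(w|v)} - θ([w]))` at `v ∤ p(pN)`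
  set P : ∀ v : HeightOneSpectrum (𝓞 ℚ), ¬ v.residueCard ∣ p * (p * N) → F[X] := fun v hv =>
    ∏ᶠ w : {w : HeightOneSpectrum (𝓞 (CyclotomicField p ℚ)) // w.under (𝓞 ℚ) = v},
      (X ^ (w.1.asIdeal.inertiaDeg (𝓞 ℚ)) -
        C ((θ (integralRayClass (modulus (CyclotomicField p ℚ) (p * N))
          (modulus_ne_bot (CyclotomicField p ℚ) (mul_ne_zero (Nat.Prime.ne_zero hp.out) hN))
          ⟨w.1.asIdeal, w.1.ne_bot, isCoprime_modulus_of_under_eq p hv w.2⟩) : Fˣ) : F))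
    with hPdef
  -- the eigenvalues: `a(v, i) = (-1)^i q_v^{-i(i-1)/2} · coeff_{n-i}(P_v)` (and `0` at bad `v`)
  set a : HeightOneSpectrum (𝓞 ℚ) → ℕ → F := fun v i =>
    if hv : ¬ v.residueCard ∣ p * (p * N) then
      (-1) ^ i * ((v.residueCard : F)⁻¹) ^ (i * (i - 1) / 2) * (P v hv).coeff ((p - 1) * 1 - i)
    else 0 with hadef
  refine ⟨a, ?_⟩
  intro v hv
  refine ⟨isUnramifiedAt_induce_of_isGaloisAvatar p hN θ ϑ hϑ hv, ?_⟩
  have hP : (FramedGaloisRep.induce ℚ (finrank_cyclotomicField p) ϑ).HasFrobCharpolyAt v (P v hv) :=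
    hasFrobCharpolyAt_induce_of_isGaloisAvatar p hN θ ϑ hϑ hv
  -- `P_v` has degree `≤ n`: it is the characteristic polynomial of an `n × n` matrix
  have hdeg : (P v hv).natDegree < (p - 1) * 1 + 1 := by
    obtain ⟨𝔓, h𝔓⟩ := v.primesAbove_nonempty
    obtain ⟨σ, hσ⟩ := HeightOneSpectrum.exists_isArithFrobAt_of_mem_primesAbove_holds h𝔓
    rw [← hP 𝔓 h𝔓 σ hσ]
    unfold FramedRep.charpoly
    rw [Matrix.charpoly_natDegree_eq_dim, Fintype.card_fin]
    exact Nat.lt_succ_self _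
  -- `q_v` is invertible in `F`
  have hq : (v.residueCard : F) ≠ 0 := by
    rw [show (v.residueCard : F) = algebraMap (ZMod p) F (v.residueCard : ZMod p) by
      rw [map_natCast], map_ne_zero_iff _ (algebraMap (ZMod p) F).injective, Ne,
      ZMod.natCast_eq_zero_iff]
    exact not_dvd_residueCard p hv
  -- the Hecke–Frobenius polynomial of `a(v, ·)` is `P_v`
  have hav : a v = fun i =>
      (-1) ^ i * ((v.residueCard : F)⁻¹) ^ (i * (i - 1) / 2) * (P v hv).coeff ((p - 1) * 1 - i) := by
    funext i
    exact dif_pos hv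
  have hpoly : heckeFrobPoly v.residueCard ((p - 1) * 1) (a v) = P v hv := by
    rw [hav]
    unfold heckeFrobPoly
    have hcoeff : ∀ i : ℕ, (-1 : F) ^ i * (v.residueCard : F) ^ (i * (i - 1) / 2) *
        ((-1) ^ i * ((v.residueCard : F)⁻¹) ^ (i * (i - 1) / 2) * (P v hv).coeff ((p - 1) * 1 - i)) =
        (P v hv).coeff ((p - 1) * 1 - i) := fun i => by
      have h1 : (-1 : F) ^ i * (v.residueCard : F) ^ (i * (i - 1) / 2) *
          ((-1) ^ i * ((v.residueCard : F)⁻¹) ^ (i * (i - 1) / 2) * (P v hv).coeff ((p - 1) * 1 - i)) =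
          ((-1) * (-1)) ^ i * ((v.residueCard : F) * (v.residueCard : F)⁻¹) ^ (i * (i - 1) / 2) *
            (P v hv).coeff ((p - 1) * 1 - i) := by
        rw [mul_pow, mul_pow]; ring
      rw [h1, neg_one_mul, neg_neg, one_pow, mul_inv_cancel₀ hq, one_pow, one_mul, one_mul]
    rw [Finset.sum_congr rfl fun i _ => by rw [hcoeff i]]
    -- `∑_{i ≤ n} coeff_{n-i} X^{n-i} = ∑_{j ≤ n} coeff_j X^j = P_v`
    have hrefl := Finset.sum_range_reflect (fun j => C ((P v hv).coeff j) * X ^ j) ((p - 1) * 1 + 1)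
    simp only [Nat.add_sub_cancel] at hrefl
    rw [hrefl]
    conv_rhs => rw [Polynomial.as_sum_range' (P v hv) ((p - 1) * 1 + 1) hdeg]
    refine Finset.sum_congr rfl fun j _ => ?_
    rw [Polynomial.C_mul_X_pow_eq_monomial]
  rw [hpoly]
  exact hP

end Ash2003

end Literature.NumberTheory.Automorphic
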